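import Mathlib
import HarnessLib
import Summits.Ventures.LatticeQCDFlow.Exactness.RejectionSamplingCapMixture
import Summits.Ventures.LatticeQCDFlow.Exactness.SU2HeatBathFromUniforms
import Summits.Ventures.LatticeQCDFlow.Exactness.BestFisherAngle

/-!
# The engine's heat-bath draws AS CODED (Kennedy–Pendleton / Creutz / Wood loops with their round caps): the exact law with probability `1 − rᶜ`, within `rᶜ` of it in total variation

HONEST FRAMING: exact (Metropolis-corrected) sampling algorithms for lattice gauge theory;
figures of merit are autocorrelation/cost numbers at stated couplings and volumes; no
continuum-physics claim.

Venture `LatticeQCDFlow` (cell pub-lqcd), topic `Exactness`, FANOUT row 9 (eng-latcore,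
`csrc/latcore_template.c: sample_a0` + `update_link` heat-bath mode, `updates.py: sample_a0_kp /
sample_a0_creutz`: per SU(2) subgroup hit with `bt = βk > 0` the code runs the Kennedy–Pendleton loop for
AT MOST `10⁴` rounds (`bt ≥ 2`) or the Creutz loop for at most `10⁵` (`bt < 2`) and returns the DEFAULT
`a₀ = 1` if no round accepted; then the axis from two uniforms and the quaternion `a₀ + √(1−a₀²) n̂·Z⃗`).
NEW WORK of the cell over the tree (`RejectionSamplingCap.lean` (`cappedLaw`) + `RejectionSamplingCapMixture.lean` (`cappedLaw_eq_mixture`,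
`abs_real_sub_le_of_eq_mixture`; gen-11/12's `KennedyPendletonSampler.lean` (`kpRound`, `kpRound_accept`,
`map_assembleSU2_loopLaw_kpRound`), `CreutzSampler.lean` (`creutzRound`, `loopLaw_creutzRound`,
`map_assembleSU2_loopLaw_creutzRound`), `SU2AxisChart.map_axisChart_unitLaw`, `SU2HeatBathSampler.assembleSU2`);
nothing is cited as a fact; no number is claimed.  `SU2HeatBathFromUniforms.lean` typed the `c = ∞` loop
("NOT CLAIMED: the round caps"); this file types the caps.

* `gaussUnit_unsplitR4_one`, `assembleSU2_one` — with the default `a₀ = 1` the assembled link is the IDENTITY of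
  `SU(2)` whatever the axis (`√(1 − 1²) = 0`); `map_assembleSU2_dirac_one` — so "default `a₀ = 1`, any axis law"
  is `δ_1` (after the staple rotation `a ↦ a ŝ†` of `update_link`: the link is set to `ŝ†`).
* `kpRound_reject` / `creutzRound_reject` — the per-round rejection probabilities
  `r = 1 − K(bt)·a0Law bt ℝ` (resp. with the Creutz constant).
* **`map_assembleSU2_kpCapped_axisChart`** — THE KP BRANCH AS CODED (`≤ c` rounds, default `a₀ = 1`, axis
  from two uniforms, assembly): its law is `(1 − rᶜ) • (the normalised one-link heat-bath law) + rᶜ • δ_1`;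
  **`abs_kpCapped_sub_linkLaw_le`** — hence within `rᶜ` of the exact heat-bath law in total variation,
  every set, every `bt > 0`, every cap `c` (the code: `c = 10⁴`).
* **`map_assembleSU2_creutzCapped_axisChart`**, **`abs_creutzCapped_sub_linkLaw_le`** — the same for the
  Creutz branch (the code: `c = 10⁵`).
* `woodRound_reject`, **`woodCapped_eq_mixture`**, **`abs_woodCapped_sub_le`** — the `cpn_2d` SITE heat bath's
  Wood cosine loop as coded (`rng_vmf_w`, cap `10⁶`, default `w = 1`): mixture identity and TV bound `r^M`
  (over `WoodSampler.loopLaw_woodRound`, `BestFisherAngle.vmfCosLaw_univ_ne_zero/_ne_top`).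

NOT CLAIMED: a numerical bound on `r` at given `bt` (it is `< 1`; `kpRound_accept` / `loopLaw_creutzRound`
give it in closed form up to `a0Law bt ℝ`); the effect accumulated over a sweep / run
(`KernelTVPerturbation.lean` carries a per-hit bound additively); the `bt ≤ 10⁻¹²` guard; floating point.
-/

noncomputable section

namespace Summit.Ventures.LatticeQCDFlow.Exactness

open MeasureTheory Measure Metric Set Real ProbabilityTheory
open scoped ENNReal

/-! ## The default branch: `a₀ = 1` assembles to one quaternion whatever the axis -/

/-- The quaternion `(1, 0, 0, 0)` assembles to the identity of `SU(2)`. -/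
theorem gaussUnit_unsplitR4_one : gaussUnit (unsplitR4 (1, 0)) = 1 := by
  have hn : ‖unsplitR4 ((1 : ℝ), (0 : E3))‖ ^ 2 = 1 := by rw [norm_sq_unsplitR4]; simp
  apply Subtype.ext
  rw [coe_gaussUnit, quatUnit, normSq_quatVec, hn, if_neg one_ne_zero, Real.sqrt_one, inv_one]
  ext i j
  fin_cases i <;> fin_cases j <;>
    simp [quatVec_apply_00, quatVec_apply_01, quatVec_apply_10, quatVec_apply_11, unsplitR4] <;> rfl

/-- **With the default `a₀ = 1` the assembled link is the IDENTITY, whatever the axis** (`√(1 − 1²) = 0`). -/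
theorem assembleSU2_one (n : sphere (0 : E3) 1) : assembleSU2 (1, n) = 1 := by
  rw [← gaussUnit_unsplitR4_one]
  simp [assembleSU2]

/-- "Default `a₀ = 1`, any axis law" is the point mass at the identity. -/
theorem map_assembleSU2_dirac_one (ν : Measure (sphere (0 : E3) 1)) [IsProbabilityMeasure ν] :
    ((Measure.dirac (1 : ℝ)).prod ν).map assembleSU2 = Measure.dirac 1 := by
  rw [Measure.dirac_prod, Measure.map_map measurable_assembleSU2 measurable_prodMk_left]
  have h : assembleSU2 ∘ Prod.mk (1 : ℝ) = fun _ : sphere (0 : E3) 1 => (1 : Matrix.specialUnitaryGroup (Fin 2) ℂ) := by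
    funext n; exact assembleSU2_one n
  rw [h, Measure.map_const, measure_univ, one_smul]

/-! ## The Kennedy–Pendleton branch as coded -/

section KP

variable {bt : ℝ}

/-- The per-round rejection probability of the Kennedy–Pendleton round: `r = 1 − K(bt)·a0Law bt ℝ`. -/
theorem kpRound_reject (hbt : 0 < bt) : kpRound bt (univ ×ˢ {false}) = 1 - kpConst bt * a0Law bt univ := by
  rw [← kpRound_accept hbt, ← one_sub_reject (ρ := kpRound bt), ENNReal.sub_sub_cancel ENNReal.one_ne_top prob_le_one]

/-- **THE KENNEDY–PENDLETON BRANCH AS CODED**: at most `c` rounds with default `a₀ = 1`, the axis from two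
uniforms, the assembly.  Its law is the normalised one-link heat-bath law with weight `1 − rᶜ` plus the
default point mass with weight `rᶜ`, `r = 1 − K(bt)·a0Law bt ℝ` (`bt > 0`). -/
theorem map_assembleSU2_kpCapped_axisChart (hbt : 0 < bt) (c : ℕ) :
    ((cappedLaw (kpRound bt) c 1).prod ((unitLaw.prod unitLaw).map axisChart)).map assembleSU2 =
      (1 - (1 - kpConst bt * a0Law bt univ) ^ c) •
        (((Literature.MathematicalPhysics.QuantumFieldTheory.haarProbability
            (Matrix.specialUnitaryGroup (Fin 2) ℂ)).withDensity
              (fun U => ENNReal.ofReal (Real.exp (bt * su2a0 U))) univ)⁻¹ •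
          (Literature.MathematicalPhysics.QuantumFieldTheory.haarProbability
            (Matrix.specialUnitaryGroup (Fin 2) ℂ)).withDensity
              (fun U => ENNReal.ofReal (Real.exp (bt * su2a0 U)))) +
      (1 - kpConst bt * a0Law bt univ) ^ c • Measure.dirac 1 := by
  have hacc : kpRound bt (univ ×ˢ {true}) ≠ 0 := by
    rw [kpRound_accept hbt]; exact mul_ne_zero (kpConst_ne_zero hbt) (a0Law_univ_ne_zero bt)
  haveI := isProbabilityMeasure_loopLaw_kpRound hbt
  rw [cappedLaw_eq_mixture hacc, kpRound_reject hbt, Measure.add_prod, Measure.prod_smul_left, Measure.prod_smul_left,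
    Measure.map_add _ _ measurable_assembleSU2, Measure.map_smul, Measure.map_smul, map_axisChart_unitLaw,
    map_assembleSU2_loopLaw_kpRound hbt, map_assembleSU2_dirac_one]

/-- **THE KP BRANCH AS CODED IS WITHIN `rᶜ` OF THE EXACT HEAT-BATH LAW IN TOTAL VARIATION**, every set,
every `bt > 0`, every cap `c` (the code uses `c = 10⁴`). -/
theorem abs_kpCapped_sub_linkLaw_le (hbt : 0 < bt) (c : ℕ) (A : Set (Matrix.specialUnitaryGroup (Fin 2) ℂ)) :
    abs ((((cappedLaw (kpRound bt) c 1).prod ((unitLaw.prod unitLaw).map axisChart)).map assembleSU2).real A -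
        (((Literature.MathematicalPhysics.QuantumFieldTheory.haarProbability
            (Matrix.specialUnitaryGroup (Fin 2) ℂ)).withDensity
              (fun U => ENNReal.ofReal (Real.exp (bt * su2a0 U))) univ)⁻¹ •
          (Literature.MathematicalPhysics.QuantumFieldTheory.haarProbability
            (Matrix.specialUnitaryGroup (Fin 2) ℂ)).withDensity
              (fun U => ENNReal.ofReal (Real.exp (bt * su2a0 U)))).real A)
      ≤ ((1 - kpConst bt * a0Law bt univ) ^ c).toReal := by
  haveI := isProbabilityMeasure_loopLaw_kpRound hbt
  -- the exact law is a probability law: it is the image of a probability law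
  haveI : IsProbabilityMeasure
      (((Literature.MathematicalPhysics.QuantumFieldTheory.haarProbability
          (Matrix.specialUnitaryGroup (Fin 2) ℂ)).withDensity
            (fun U => ENNReal.ofReal (Real.exp (bt * su2a0 U))) univ)⁻¹ •
        (Literature.MathematicalPhysics.QuantumFieldTheory.haarProbability
          (Matrix.specialUnitaryGroup (Fin 2) ℂ)).withDensity
            (fun U => ENNReal.ofReal (Real.exp (bt * su2a0 U)))) := by
    rw [← map_assembleSU2_loopLaw_kpRound hbt]
    exact isProbabilityMeasure_map measurable_assembleSU2.aemeasurable
  exact abs_real_sub_le_of_eq_mixture (pow_le_one₀ zero_le (tsub_le_self))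
    (map_assembleSU2_kpCapped_axisChart hbt c) A

end KP

/-! ## The Creutz branch as coded -/

section Creutz

variable {bt : ℝ}

/-- The per-round rejection probability of the Creutz round: `r = 1 − C(bt)·a0Law bt ℝ`. -/
theorem creutzRound_reject (hbt : 0 < bt) :
    creutzRound bt (univ ×ˢ {false}) = 1 - creutzConst bt * a0Law bt univ := by
  haveI : IsProbabilityMeasure (creutzRound bt) := isProbabilityMeasure_sqrtThinRound (measurable_creutzProposal bt)
  rw [← (loopLaw_creutzRound hbt).1, ← one_sub_reject (ρ := creutzRound bt),
    ENNReal.sub_sub_cancel ENNReal.one_ne_top prob_le_one]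

/-- **THE CREUTZ BRANCH AS CODED**: at most `c` rounds with default `a₀ = 1`, the axis from two uniforms,
the assembly: the normalised one-link heat-bath law with weight `1 − rᶜ` plus the default point mass with
weight `rᶜ`, `r = 1 − C(bt)·a0Law bt ℝ` (`bt > 0`). -/
theorem map_assembleSU2_creutzCapped_axisChart (hbt : 0 < bt) (c : ℕ) :
    ((cappedLaw (creutzRound bt) c 1).prod ((unitLaw.prod unitLaw).map axisChart)).map assembleSU2 =
      (1 - (1 - creutzConst bt * a0Law bt univ) ^ c) •
        (((Literature.MathematicalPhysics.QuantumFieldTheory.haarProbability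
            (Matrix.specialUnitaryGroup (Fin 2) ℂ)).withDensity
              (fun U => ENNReal.ofReal (Real.exp (bt * su2a0 U))) univ)⁻¹ •
          (Literature.MathematicalPhysics.QuantumFieldTheory.haarProbability
            (Matrix.specialUnitaryGroup (Fin 2) ℂ)).withDensity
              (fun U => ENNReal.ofReal (Real.exp (bt * su2a0 U)))) +
      (1 - creutzConst bt * a0Law bt univ) ^ c • Measure.dirac 1 := by
  haveI : IsProbabilityMeasure (creutzRound bt) := isProbabilityMeasure_sqrtThinRound (measurable_creutzProposal bt)
  have hK0 : creutzConst bt ≠ 0 := by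
    have hem0 : 0 < 1 - Real.exp (-2 * bt) := by linarith [exp_neg_two_mul_lt_one hbt]
    rw [creutzConst, Ne, ENNReal.ofReal_eq_zero, not_le]; positivity
  have hacc : creutzRound bt (univ ×ˢ {true}) ≠ 0 := by
    rw [(loopLaw_creutzRound hbt).1]; exact mul_ne_zero hK0 (a0Law_univ_ne_zero bt)
  haveI := (loopLaw_creutzRound hbt).2.2
  rw [cappedLaw_eq_mixture hacc, creutzRound_reject hbt, Measure.add_prod, Measure.prod_smul_left, Measure.prod_smul_left,
    Measure.map_add _ _ measurable_assembleSU2, Measure.map_smul, Measure.map_smul, map_axisChart_unitLaw,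
    map_assembleSU2_loopLaw_creutzRound hbt, map_assembleSU2_dirac_one]

/-- **THE CREUTZ BRANCH AS CODED IS WITHIN `rᶜ` OF THE EXACT HEAT-BATH LAW IN TOTAL VARIATION** (the code
uses `c = 10⁵`). -/
theorem abs_creutzCapped_sub_linkLaw_le (hbt : 0 < bt) (c : ℕ) (A : Set (Matrix.specialUnitaryGroup (Fin 2) ℂ)) :
    abs ((((cappedLaw (creutzRound bt) c 1).prod ((unitLaw.prod unitLaw).map axisChart)).map assembleSU2).real A -
        (((Literature.MathematicalPhysics.QuantumFieldTheory.haarProbability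
            (Matrix.specialUnitaryGroup (Fin 2) ℂ)).withDensity
              (fun U => ENNReal.ofReal (Real.exp (bt * su2a0 U))) univ)⁻¹ •
          (Literature.MathematicalPhysics.QuantumFieldTheory.haarProbability
            (Matrix.specialUnitaryGroup (Fin 2) ℂ)).withDensity
              (fun U => ENNReal.ofReal (Real.exp (bt * su2a0 U)))).real A)
      ≤ ((1 - creutzConst bt * a0Law bt univ) ^ c).toReal := by
  haveI := (loopLaw_creutzRound hbt).2.2
  haveI : IsProbabilityMeasure
      (((Literature.MathematicalPhysics.QuantumFieldTheory.haarProbability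
          (Matrix.specialUnitaryGroup (Fin 2) ℂ)).withDensity
            (fun U => ENNReal.ofReal (Real.exp (bt * su2a0 U))) univ)⁻¹ •
        (Literature.MathematicalPhysics.QuantumFieldTheory.haarProbability
          (Matrix.specialUnitaryGroup (Fin 2) ℂ)).withDensity
            (fun U => ENNReal.ofReal (Real.exp (bt * su2a0 U)))) := by
    rw [← map_assembleSU2_loopLaw_creutzRound hbt]
    exact isProbabilityMeasure_map measurable_assembleSU2.aemeasurable
  exact abs_real_sub_le_of_eq_mixture (pow_le_one₀ zero_le (tsub_le_self))
    (map_assembleSU2_creutzCapped_axisChart hbt c) A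

end Creutz

/-! ## The `cpn_2d` site heat bath's Wood loop as coded (`csrc/cpn_kernel.c: rng_vmf_w`, `M = 10⁶`, default `w = 1`) -/

section Wood

variable {κ δ : ℝ}

/-- One Wood round is a probability law (`δ > 0`). -/
theorem isProbabilityMeasure_woodRound (hδ : 0 < δ) : IsProbabilityMeasure (woodRound κ δ) := by
  haveI : IsProbabilityMeasure (betaMeasure (δ / 2) (δ / 2)) :=
    isProbabilityMeasureBeta (by positivity) (by positivity)
  haveI : IsProbabilityMeasure ((betaMeasure (δ / 2) (δ / 2)).map (woodW (woodB κ δ))) :=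
    isProbabilityMeasure_map (measurable_woodW _).aemeasurable
  unfold woodRound
  exact isProbabilityMeasure_thinning _ (measurable_woodAccept κ δ) (woodAccept_le_one κ δ)

/-- The per-round rejection probability of Wood's round: `r = 1 − K·vmfCosLaw κ δ ℝ` (`κ ≥ 0`, `δ > 0`). -/
theorem woodRound_reject (hκ : 0 ≤ κ) (hδ : 0 < δ) :
    woodRound κ δ (univ ×ˢ {false}) = 1 - woodConst κ δ * vmfCosLaw κ δ univ := by
  haveI := isProbabilityMeasure_woodRound (κ := κ) hδ
  rw [← woodRound_accept hκ hδ, ← one_sub_reject (ρ := woodRound κ δ),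
    ENNReal.sub_sub_cancel ENNReal.one_ne_top prob_le_one]

/-- **THE `cpn_2d` SITE HEAT BATH'S COSINE DRAW AS CODED** (Wood's loop capped at `M` rounds — the code uses
`M = 10⁶` — with default `w = 1`): its law is `(1 − r^M) • (the normalised vMF cosine law) + r^M • δ_1`,
`r = 1 − K·vmfCosLaw κ δ ℝ` (`κ ≥ 0`, `δ = 2N − 1 > 0`). -/
theorem woodCapped_eq_mixture (hκ : 0 ≤ κ) (hδ : 0 < δ) (M : ℕ) :
    cappedLaw (woodRound κ δ) M 1 =
      (1 - (1 - woodConst κ δ * vmfCosLaw κ δ univ) ^ M) • ((vmfCosLaw κ δ univ)⁻¹ • vmfCosLaw κ δ) +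
        (1 - woodConst κ δ * vmfCosLaw κ δ univ) ^ M • Measure.dirac 1 := by
  haveI := isProbabilityMeasure_woodRound (κ := κ) hδ
  have hacc : woodRound κ δ (univ ×ˢ {true}) ≠ 0 := by
    rw [woodRound_accept hκ hδ]; exact mul_ne_zero (woodConst_ne_zero hδ) (vmfCosLaw_univ_ne_zero κ δ)
  rw [cappedLaw_eq_mixture hacc, woodRound_reject hκ hδ, loopLaw_woodRound hκ hδ]

/-- **… AND IT IS WITHIN `r^M` OF THE EXACT COSINE LAW IN TOTAL VARIATION**, every set. -/
theorem abs_woodCapped_sub_le (hκ : 0 ≤ κ) (hδ : 0 < δ) (M : ℕ) (A : Set ℝ) :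
    |(cappedLaw (woodRound κ δ) M 1).real A - ((vmfCosLaw κ δ univ)⁻¹ • vmfCosLaw κ δ).real A|
      ≤ ((1 - woodConst κ δ * vmfCosLaw κ δ univ) ^ M).toReal := by
  haveI := isProbabilityMeasure_woodRound (κ := κ) hδ
  haveI := isProbabilityMeasure_loopLaw_woodRound hκ hδ
  haveI : IsProbabilityMeasure ((vmfCosLaw κ δ univ)⁻¹ • vmfCosLaw κ δ) := by
    rw [← loopLaw_woodRound hκ hδ]; infer_instance
  exact abs_real_sub_le_of_eq_mixture (pow_le_one₀ zero_le (tsub_le_self)) (woodCapped_eq_mixture hκ hδ M) A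

end Wood

end Summit.Ventures.LatticeQCDFlow.Exactness
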